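import Summits.BirchSwinnertonDyer.Rank1Residual.Additive.TameBranchAnalyticShaLaw
import Summits.BirchSwinnertonDyer.Rank1Residual.Additive.TameBranchRatCharEqBinderFree
import HarnessLib

/-!
# THE A′-INEQUALITY ALONE — rank 1, the (M) and X3 twins, EVERY odd `p`: X4(M) ∩ {`ρ̄` onto} (Kato),
# X3♯(G-ord, `e = 2`) ∩ `I₀*` and X3♯(M) (Wuthrich, `E[p]` reducible): `[T¹](ϖ·S) ≠ 0` +
# **`v_p([T¹](ϖ·S)) + 1 + 2t ≤ v + ord_p ∏c`** (`v ≤ ord_p Reg_p`) ⟹ `TameBranchRatCharEqAt W p`, Schneider,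
# `ord_p Reg_p = v`, `Ш[p^∞] = 0` — the first-unit-index datum of gen 31's twins deleted
# (cell `b2b-bsdres`, sub-cell additive-p2 = X3♯(G-ord)/X4♯(G-ord), gen 32; part 7)

HONEST FRAMING (cell `b2b-bsdres`, run/shared/lean/b2b/bsd-rank1-residual/, verbatim in every
file): the goal of the cell is to DELETE the COMBINATION-SHAPED residual classes of the
Birch–Swinnerton-Dyer formula for ALL analytic-rank `≤ 1` elliptic curves over `ℚ` — "full BSD
formula for every rank `≤ 1` curve in class `C`" assembled STRICTLY from published theorems — so
that the rank-`≤ 1` remainder becomes exactly the CONSTRUCTION-SHAPED classes, which are TYPED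
(missing-input `Prop`s), NOT attempted. This is not "finishing BSD". Sub-cell additive-p2: the
classes X3♯(G-ord) / X4♯(G-ord) are CONSTRUCTION-SHAPED and stay so; the (M) rows belong to
additive-p1 / n1011 (bricks and class predicates consumed BY NAME); labels / RESIDUAL-MAP marks
UNCHANGED; nothing is booked (`BSD(E,p)` at rank 1 needs the branch `p`-adic Gross–Zagier formula, NOT
in print). Theorems only; published inputs are explicit binders (`hK` Kato 2004 Thm. 17.4 (3), `hWu`
Wuthrich 2014 Thm. 16, `hmodD`, `hGZK`, `LeadingTermClauses W p Dh` = Delbourgo 2002 (B) for the datum: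
`mainTheorem_potMult` on (M), A175 / `mainTheorem_three` on (G-ord)). No definition, no named fact,
no `sorry`.

## What and why

Part 3 (`TameBranchAnalyticShaRankOne`) deleted the first-unit-index datum from gen 31's rank-one route
on X4♯(G-ord, `e = 2`). The X4-2 WINDOW's 429 certified rank-one rows are, but for one, X3 or (M) rows
((M)@3: 233 X3 + 36 X4; Gord3@3: 121 X3 + 7 X4; (M)@5: 15 X3 + 3 X4; Gord_e2@5: 13 X3 + 1 X4). THIS FILE
gives their class-level A′-only statements over ONE series-agnostic per-datum step (§0
`charIdeal_eq_span_of_iota_eq_C_mul_of_linearCoeff_rankOne`: ANY `g ∈ char_Λ X`, `ι g = C(u·c)·S`,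
`[T¹](c·S) ≠ 0`, `v ≤ ord_p Reg_p`, `v_p([T¹](c·S)) + 1 + 2t ≤ v + ord_p ∏c` ⟹ Schneider, `char = (g)`,
`ord_p Reg_p = v`, `#Ш[p^∞] = 1`):

* **`ClassX4M.tameBranchRatCharEqAt_of_katoHalf_of_linearCoeff_rankOne`** (X4(M) ∩ {`ρ̄` onto}, every
  odd `p`, n1011-p17's brick);
* **`ClassX3Gord.tameBranchRatCharEqAt_of_wuthrichHalf_of_linearCoeff_rankOne`** (X3♯(G-ord, `e = 2`) ∩
  `I₀*`, every odd `p`, gen 19's Wuthrich brick);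
* **`ClassX3M.tameBranchRatCharEqAt_of_wuthrichHalf_of_linearCoeff_rankOne`** (X3♯(M), every odd `p`,
  n1011-p07's brick).

Hypotheses = gen 31's `…_fullSqueeze_rankOne[']` with the clauses `‖[Tⁿ]‖ = 1 ∧ ∀ i < n, ‖[Tⁱ]‖ < 1`
DELETED (and the plus-symbol binder discharged by `exists_ratPlusSymbol_ne_zero_of_isNewformOf`). So on
EVERY defect-2 rank-one row except X4 ∩ Gord3 @ 3 the census's `v_p(A′) + 2t = v_h + ord_p(#Ш_an∏c/#T²)`
(429/429) is the hypothesis verbatim GIVEN `Reg_p(⟨,⟩_{p,ℚ}) ↔ h`. Nothing booked; labels UNCHANGED.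

References: Kato 2004 Thm. 17.4 (3) [Kato2004Asterisque]; Wuthrich 2014 Thm. 16, Lemma 20 [Wuthrich2014];
Delbourgo 2002 Thm. (A), (B) p. 40, p. 39 [Delbourgo2002]; Greenberg LNM 1716 §4 [GreenbergLNM1716];
Mazur–Tate–Teitelbaum 1986 §I.10, §I.13–I.14 [MazurTateTeitelbaum1986Invent]; gen 31 parts 5/7b/7c/8,
gen 32 parts 1/3. -/

set_option autoImplicit false

noncomputable section

open scoped Classical MatrixGroups ModularForm NumberField

open CongruenceSubgroup IsDedekindDomain WeierstrassCurve NumberField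
  Literature.NumberTheory.EllipticCurves
  Literature.NumberTheory.EllipticCurves.ModularForms
  Literature.NumberTheory.EllipticCurves.Rank1Residual
  Literature.NumberTheory.EllipticCurves.Rank1Residual.Typed
  Literature.NumberTheory.EllipticCurves.Delbourgo2002
  Literature.NumberTheory.GaloisRepresentations
  Summit.BirchSwinnertonDyer.Rank1Residual.AdditivePotMult
  Summit.BirchSwinnertonDyer.Rank1Residual.X1.MuLambda
  Summit.BirchSwinnertonDyer.Rank1Residual.X1.RankOneParitySqueeze
  Summit.BirchSwinnertonDyer.Rank1Residual.X11a.LambdaNorm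

namespace Summit.BirchSwinnertonDyer.Rank1Residual.Additive

/-! ### §0 Per datum, series-agnostic, rank one -/

namespace TameBranchAnalyticSha

open TameBranchMuPart

variable {W : WeierstrassCurve ℚ} [W.IsElliptic] {p : ℕ} [hp : Fact p.Prime]

/-- **Per datum, series-agnostic rank-1 step.** `p ≠ 2`, `rank_ℤ E(ℚ) = 1`, a (B)-datum `Dh`, a cyclotomic
dual datum with `X` torsion, ANY `g ∈ char_Λ X` with `ι g = C(u·c)·S` (`u ∈ ℤ_p^×`), `[T¹](c·S) ≠ 0`,
`v ≤ ord_p Reg_p(E,Dh)` and **`v_p([T¹](c·S)) + 1 + 2·ord_p #tors ≤ v + ord_p ∏c`**. Then Schneider,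
**`char_Λ X = (g)`**, **`ord_p Reg_p(E,Dh) = v`**, **`#Ш(E/ℚ)[p^∞] = 1`** (part 1's `fullSqueeze_rankOne_of_iota_eq`).
[cite: GreenbergLNM1716, §4 pp. 102–110] [cite: Delbourgo2002, Theorem (B) (p. 40)] -/
theorem charIdeal_eq_span_of_iota_eq_C_mul_of_linearCoeff_rankOne (hp2 : p ≠ 2)
    (hr1 : W.mordellWeilRank = 1) {Dh : PAdicHeightData W p} (hBcl : LeadingTermClauses W p Dh)
    {κ : ZpExtension ℚ p} {γ : Field.absoluteGaloisGroup ℚ}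
    (hκ : κ.IsCyclotomic) (hγ : κ.IsTopGenerator γ) (hγ' : IsCyclotomicVariable p γ)
    (D : W.SelmerDualData κ γ) [Module.Finite (IwasawaAlgebra p) D.X] (hX : D.IsTorsion)
    {g : IwasawaAlgebra p} (hg : g ∈ D.charIdeal) {u : ℤ_[p]ˣ} {c : ℚ_[p]} {S : PowerSeries ℚ_[p]}
    (hι : iwasawaToPowerSeries p g = PowerSeries.C (((u : ℤ_[p]) : ℚ_[p]) * c) * S)
    (h1 : PowerSeries.coeff 1 (PowerSeries.C c * S) ≠ 0) {v : ℤ} (hv : v ≤ (padicRegulator Dh).valuation)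
    (hfull : (PowerSeries.coeff 1 (PowerSeries.C c * S)).valuation + 1 + 2 * padicValNat p W.torsionOrder ≤
      v + padicValNat p W.tamagawaProduct) :
    SchneiderConjecture Dh ∧ D.charIdeal = Ideal.span {g} ∧ (padicRegulator Dh).valuation = v ∧
      Nat.card (AddCommGroup.primaryComponent W.sha p) = 1 := by
  have hX1 : PowerSeries.coeff 1 (PowerSeries.C (((u : ℤ_[p]) : ℚ_[p]) * c) * S) ≠ 0 := by
    rw [PowerSeries.coeff_C_mul, mul_assoc]
    rw [PowerSeries.coeff_C_mul] at h1
    exact mul_ne_zero (coe_units_ne_zero p u) h1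
  have hfull' := hfull
  rw [← valuation_coeff_C_unit_mul u _ _ 1 h1] at hfull'
  haveI : (Literature.NumberTheory.EllipticCurves.Module.charIdeal (IwasawaAlgebra p) D.X).IsPrincipal :=
    charIdeal_isPrincipal_holds p D.X
  obtain ⟨fE, hchar⟩ := Submodule.IsPrincipal.principal
    (Literature.NumberTheory.EllipticCurves.Module.charIdeal (IwasawaAlgebra p) D.X)
  obtain ⟨hS, hspan, -, -, hcard, hReg, -⟩ := fullSqueeze_rankOne_of_iota_eq hp2 hr1 hBcl hκ hγ hγ' D hX
    hchar hg hι hX1 hv hfull'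
  exact ⟨hS, hspan, hReg, hcard⟩

end TameBranchAnalyticSha

section Twins

open TameBranchMuPart TameBranchAnalyticSha

variable {W : WeierstrassCurve ℚ} [W.IsElliptic] [W.IsGloballyMinimal] {p : ℕ} [hp : Fact p.Prime]

/-! ### §1 X4(M) ∩ {`ρ̄` onto}, EVERY odd `p` -/

/-- **HEADLINE (M), RANK ONE: THE A′-INEQUALITY ALONE.** X4(M) ∩ {`ρ̄_{E,p}` onto}, EVERY odd `p`,
`ord_{s=1} L(E,s) = 1`, a (B)-datum `Dh` (`mainTheorem_potMult`), `v ≤ ord_p Reg_p(E,Dh)`; per pair, for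
every multiplicative twist model, newform with `a_p = ap` and period ratio: ONLY `[T¹](ϖ·L^±_p(f, ap)) ≠ 0`
and **`v_p([T¹](ϖ·L^±)) + 1 + 2·ord_p #tors ≤ v + ord_p ∏c_ℓ`**. Then **`TameBranchRatCharEqAt W p`**,
Schneider, **`ord_p Reg_p(E,Dh) = v`**, **`#Ш(E/ℚ)[p^∞] = 1`** — gen 31's `…_fullSqueeze_rankOne` with the
first-unit-index clauses DELETED. [cite: Kato2004Asterisque, Thm. 17.4 (3) (p. 273)] [cite: Wuthrich2014, Lemma 20]
[cite: Delbourgo2002, Theorem (A), (B) (p. 40), p. 39] [cite: MazurTateTeitelbaum1986Invent, §I.10, §I.13–I.14] -/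
theorem ClassX4M.tameBranchRatCharEqAt_of_katoHalf_of_linearCoeff_rankOne
    (hK : Wuthrich2014.kato_halfEigenCharIdeal_dvd_cyclotomicPrime_of_surjective)
    (hmodD : nonempty_modularParametrizationData)
    (hGZK : rank_eq_analyticRank_of_analyticRank_le_one)
    (hX : ClassX4M W p) (hsurj : Surj W p) (hr : W.analyticRank = 1)
    {Dh : PAdicHeightData W p} (hBcl : LeadingTermClauses W p Dh)
    {v : ℤ} (hv : v ≤ (padicRegulator Dh).valuation)
    (hcert : ∀ (V : WeierstrassCurve ℚ) [V.IsElliptic] [V.IsGloballyMinimal] (C : VariableChange ℚ),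
      Mult V p → C • V.quadraticTwist ((-1 : ℚ) ^ (p / 2) * p) = W →
      ∀ {N : ℕ} [NeZero N] (f : CuspForm (Gamma0 N) 2), IsNewformOf V f → ∀ (ap : ℤ), cuspCoeff f p = ap →
      ∀ ϖ : ℚ, (if Even (p / 2) then (ϖ : ℝ) * V.realPeriodRat = plusPeriod f
          else (ϖ : ℝ) * V.imaginaryPeriodRat = minusPeriod f) →
        PowerSeries.coeff 1 (PowerSeries.C (ϖ : ℚ_[p]) *
            (if Even (p / 2) then padicLFunctionPlusBranchMult f ((ap : ℤ) : ℚ_[p]) (p / 2)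
              else padicLFunctionMinusBranchMult f ((ap : ℤ) : ℚ_[p]) (p / 2))) ≠ 0 ∧
        (PowerSeries.coeff 1 (PowerSeries.C (ϖ : ℚ_[p]) *
            (if Even (p / 2) then padicLFunctionPlusBranchMult f ((ap : ℤ) : ℚ_[p]) (p / 2)
              else padicLFunctionMinusBranchMult f ((ap : ℤ) : ℚ_[p]) (p / 2)))).valuation +
            1 + 2 * padicValNat p W.torsionOrder ≤ v + padicValNat p W.tamagawaProduct) :
    TameBranchRatCharEqAt W p ∧ SchneiderConjecture Dh ∧ (padicRegulator Dh).valuation = v ∧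
      Nat.card (AddCommGroup.primaryComponent W.sha p) = 1 := by
  have hp2 : p ≠ 2 := hX.p_ne_two
  obtain ⟨hmw, -⟩ := hGZK W (by rw [hr])
  have hr1 : W.mordellWeilRank = 1 := by rw [hmw, hr]
  obtain ⟨V, iV, iVm, C, hV, hC⟩ := hX.exists_mult_pStar_twist_model
  haveI : NeZero (V.conductorNorm ℤ) := ⟨(V.conductorNorm_pos_holds).ne'⟩
  obtain ⟨Dm⟩ := hmodD V
  obtain ⟨ϖ, hϖ⟩ := exists_periodRatio_parity (p := p) V Dm
  have hsurjV : ∀ n : ℕ, V.HasSurjectiveModNGaloisRep (p ^ n : ℕ) :=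
    (ClassX4M.potMult W p hX).towerSurj_twist_of_surj hp2 hsurj V C hC
  -- the sign `a_p(E♭) = ±1` and Kato's element for every cyclotomic datum
  have hsign : ∃ ap : ℤ, cuspCoeff Dm.f p = ap ∧
      ∀ (κ : ZpExtension ℚ p) (γ : Field.absoluteGaloisGroup ℚ), κ.IsCyclotomic → κ.IsTopGenerator γ →
        IsCyclotomicVariable p γ → ∀ D : W.SelmerDualData κ γ,
        D.IsTorsion ∧ ∃ g ∈ D.charIdeal, ∃ u : ℤ_[p]ˣ,
          iwasawaToPowerSeries p g = PowerSeries.C (((u : ℤ_[p]) : ℚ_[p]) * (ϖ : ℚ_[p])) *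
            (if Even (p / 2) then padicLFunctionPlusBranchMult Dm.f ((ap : ℤ) : ℚ_[p]) (p / 2)
              else padicLFunctionMinusBranchMult Dm.f ((ap : ℤ) : ℚ_[p]) (p / 2)) := by
    by_cases hs : V.HasSplitMultiplicativeReductionAtPrime p
    · refine ⟨1, (Dm.isNewformOf.cuspCoeff_eq_one_and_sq_of_split hs).1.trans (by norm_num),
        fun κ γ hκ hγ hcv D ↦ ?_⟩
      simpa only [Int.cast_one] using isTorsion_and_exists_iota_eq_of_katoHalf hK hp2 V C hC hsurjV hκ
        hγ hcv Dm.isNewformOf D _ (Or.inr (Or.inl ⟨hs, rfl⟩)) ϖ hϖ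
    · refine ⟨-1, (Dm.isNewformOf.cuspCoeff_eq_neg_one_and_dvd_of_nonsplit hV hs).1.trans
        (by norm_num), fun κ γ hκ hγ hcv D ↦ ?_⟩
      simpa only [Int.cast_neg, Int.cast_one] using isTorsion_and_exists_iota_eq_of_katoHalf hK hp2 V C
        hC hsurjV hκ hγ hcv Dm.isNewformOf D _ (Or.inr (Or.inr ⟨hV, hs, rfl⟩)) ϖ hϖ
  obtain ⟨ap, hap, hbrick⟩ := hsign
  obtain ⟨h1, hfull⟩ := hcert V C hV hC Dm.f Dm.isNewformOf ap hap ϖ hϖ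
  have hϖ0 : ϖ ≠ 0 := by
    rintro rfl; apply h1; rw [Rat.cast_zero, map_zero, zero_mul, map_zero]
  have hB0 : (if Even (p / 2) then padicLFunctionPlusBranchMult Dm.f ((ap : ℤ) : ℚ_[p]) (p / 2)
      else padicLFunctionMinusBranchMult Dm.f ((ap : ℤ) : ℚ_[p]) (p / 2)) ≠ 0 := by
    intro e; apply h1; rw [e, mul_zero, map_zero]
  have core : ∀ (κ : ZpExtension ℚ p) (γ : Field.absoluteGaloisGroup ℚ), κ.IsCyclotomic →
      κ.IsTopGenerator γ → IsCyclotomicVariable p γ → ∀ D : W.SelmerDualData κ γ,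
      D.IsTorsion ∧ SchneiderConjecture Dh ∧ (padicRegulator Dh).valuation = v ∧
        Nat.card (AddCommGroup.primaryComponent W.sha p) = 1 ∧ ∃ (g : IwasawaAlgebra p) (u : ℤ_[p]ˣ),
        D.charIdeal = Ideal.span {g} ∧ iwasawaToPowerSeries p g =
          PowerSeries.C (((u : ℤ_[p]) : ℚ_[p]) * (ϖ : ℚ_[p])) *
            (if Even (p / 2) then padicLFunctionPlusBranchMult Dm.f ((ap : ℤ) : ℚ_[p]) (p / 2)
              else padicLFunctionMinusBranchMult Dm.f ((ap : ℤ) : ℚ_[p]) (p / 2)) := by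
    intro κ γ hκ hγ hγ' D
    haveI : Module.Finite (IwasawaAlgebra p) D.X :=
      SelmerDualData.module_finite_of_isCyclotomic (W := W) (κ := κ) hκ D hγ
    obtain ⟨hXt, g, hg, u, hι⟩ := hbrick κ γ hκ hγ hγ' D
    obtain ⟨hS, hspan, hReg, hcard⟩ := charIdeal_eq_span_of_iota_eq_C_mul_of_linearCoeff_rankOne hp2 hr1
      hBcl hκ hγ hγ' D hXt hg hι h1 hv hfull
    exact ⟨hXt, hS, hReg, hcard, g, u, hspan, hι⟩
  obtain ⟨κ₀, γ₀, hκ₀, hγ₀, hγ₀', D₀, -, -⟩ := exists_cyclotomic_dualData_generator W p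
  obtain ⟨-, hS, hReg, hcard, -⟩ := core κ₀ γ₀ hκ₀ hγ₀ hγ₀' D₀
  refine ⟨?_, hS, hReg, hcard⟩
  intro κ γ N _ f ε α B _ haddv _ hκ hγ hcv hf _ hα hB D
  obtain ⟨hXt, -, -, -, g₁, u, hspan, hι⟩ := core κ γ hκ hγ hcv D
  exact ⟨hXt, exists_charIdeal_eq_span_and_iota_eq_of_generator_mult hp2 V C hC haddv hV hf
    (exists_ratPlusSymbol_ne_zero_of_isNewformOf hf) Dm hap hϖ0 hspan hι hB0 hα hB⟩

/-! ### §2 X3♯(G-ord, `e = 2`) ∩ `I₀*` (`E[p]` reducible), EVERY odd `p` -/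

/-- **HEADLINE X3♯(G-ord), RANK ONE: THE A′-INEQUALITY ALONE.** X3♯(G-ord) ∩ `I₀*` (`E[p]` reducible), `p`
odd, `ord_{s=1} L(E,s) = 1`, a (B)-datum `Dh` (A175 at `p ≥ 5`, `mainTheorem_three` at `p = 3`),
`v ≤ ord_p Reg_p(E,Dh)`; per pair ONLY `[T¹](ϖ·B^±) ≠ 0` and **`v_p([T¹](ϖ·B^±)) + 1 + 2·ord_p #tors ≤ v +
ord_p ∏c_ℓ`**. Then **`TameBranchRatCharEqAt W p`**, Schneider, **`ord_p Reg_p(E,Dh) = v`**, **`#Ш(E/ℚ)[p^∞] = 1`**.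
[cite: Wuthrich2014, Thm. 16 (p. 397)] [cite: Delbourgo2002, Theorem (B) (p. 40)]
[cite: GreenbergLNM1716, §4 pp. 102–110] [cite: MazurTateTeitelbaum1986Invent, §I.13–I.14] -/
theorem ClassX3Gord.tameBranchRatCharEqAt_of_wuthrichHalf_of_linearCoeff_rankOne
    (hWu : Wuthrich2014.thm16_halfEigenCharIdeal_dvd_cyclotomicPrime)
    (hmodD : nonempty_modularParametrizationData)
    (hGZK : rank_eq_analyticRank_of_analyticRank_le_one)
    (hX : ClassX3Gord W p) (hp2 : p ≠ 2) (he : semistabilityIndex W p = 2)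
    (hr : W.analyticRank = 1) {Dh : PAdicHeightData W p} (hBcl : LeadingTermClauses W p Dh)
    {v : ℤ} (hv : v ≤ (padicRegulator Dh).valuation)
    (hcert : ∀ (V : WeierstrassCurve ℚ) [V.IsElliptic] [V.IsGloballyMinimal] (C : VariableChange ℚ),
      C • V.quadraticTwist ((-1 : ℚ) ^ (p / 2) * p) = W → IsOrdinaryAt V p →
      ∀ {N : ℕ} [NeZero N] (f : CuspForm (Gamma0 N) 2), IsNewformOf V f →
      ∀ ϖ : ℚ, (if Even (p / 2) then (ϖ : ℝ) * V.realPeriodRat = plusPeriod f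
          else (ϖ : ℝ) * V.imaginaryPeriodRat = minusPeriod f) →
        PowerSeries.coeff 1 (PowerSeries.C (ϖ : ℚ_[p]) *
            (if Even (p / 2) then padicLFunctionBranch f ((unitRoot V p : ℤ_[p]) : ℚ_[p]) (p / 2)
              else padicLFunctionMinusBranch f ((unitRoot V p : ℤ_[p]) : ℚ_[p]) (p / 2))) ≠ 0 ∧
        (PowerSeries.coeff 1 (PowerSeries.C (ϖ : ℚ_[p]) *
            (if Even (p / 2) then padicLFunctionBranch f ((unitRoot V p : ℤ_[p]) : ℚ_[p]) (p / 2)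
              else padicLFunctionMinusBranch f ((unitRoot V p : ℤ_[p]) : ℚ_[p]) (p / 2)))).valuation +
            1 + 2 * padicValNat p W.torsionOrder ≤ v + padicValNat p W.tamagawaProduct) :
    TameBranchRatCharEqAt W p ∧ SchneiderConjecture Dh ∧ (padicRegulator Dh).valuation = v ∧
      Nat.card (AddCommGroup.primaryComponent W.sha p) = 1 := by
  obtain ⟨hmw, -⟩ := hGZK W (by rw [hr])
  have hr1 : W.mordellWeilRank = 1 := by rw [hmw, hr]
  obtain ⟨V, iV, iVm, C, hV, hC⟩ := hX.exists_goodOrd_pStar_twist_model W p hp2 he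
  haveI : NeZero (V.conductorNorm ℤ) := ⟨(V.conductorNorm_pos_holds).ne'⟩
  obtain ⟨Dm⟩ := hmodD V
  obtain ⟨ϖ, hϖ⟩ := exists_periodRatio_parity (p := p) V Dm
  have hj := padicValRat_j_nonneg_of_typeGOrd W p hX.typeGOrd
  have hord : IsOrdinaryAt V p :=
    isOrdinaryAt_of_goodOrd_or_mult_of_model_twist W V (pStar_ne_zero p) ⟨C, hC⟩ hj (Or.inl hV)
  obtain ⟨h1, hfull⟩ := hcert V C hC hord Dm.f Dm.isNewformOf ϖ hϖ
  have hϖ0 : ϖ ≠ 0 := by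
    rintro rfl; apply h1; rw [Rat.cast_zero, map_zero, zero_mul, map_zero]
  have hB0 : (if Even (p / 2) then padicLFunctionBranch Dm.f ((unitRoot V p : ℤ_[p]) : ℚ_[p]) (p / 2)
      else padicLFunctionMinusBranch Dm.f ((unitRoot V p : ℤ_[p]) : ℚ_[p]) (p / 2)) ≠ 0 := by
    intro e; apply h1; rw [e, mul_zero, map_zero]
  have core : ∀ (κ : ZpExtension ℚ p) (γ : Field.absoluteGaloisGroup ℚ), κ.IsCyclotomic →
      κ.IsTopGenerator γ → IsCyclotomicVariable p γ → ∀ D : W.SelmerDualData κ γ,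
      D.IsTorsion ∧ SchneiderConjecture Dh ∧ (padicRegulator Dh).valuation = v ∧
        Nat.card (AddCommGroup.primaryComponent W.sha p) = 1 ∧ ∃ (g : IwasawaAlgebra p) (u : ℤ_[p]ˣ),
        D.charIdeal = Ideal.span {g} ∧ iwasawaToPowerSeries p g =
          PowerSeries.C (((u : ℤ_[p]) : ℚ_[p]) * (ϖ : ℚ_[p])) *
            (if Even (p / 2) then padicLFunctionBranch Dm.f ((unitRoot V p : ℤ_[p]) : ℚ_[p]) (p / 2)
              else padicLFunctionMinusBranch Dm.f ((unitRoot V p : ℤ_[p]) : ℚ_[p]) (p / 2)) := by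
    intro κ γ hκ hγ hγ' D
    haveI : Module.Finite (IwasawaAlgebra p) D.X :=
      SelmerDualData.module_finite_of_isCyclotomic (W := W) (κ := κ) hκ D hγ
    obtain ⟨hXt, g, hg, u, hι⟩ := isTorsion_and_exists_iota_eq_branch_of_wuthrichComponent W p
      (Wuthrich2014.charIdeal_dvd_padicLFunctionBranch_component_of_half hWu) hj hp2 V
      ⟨C, hC⟩ (Or.inl hV) hX.classX3.1 hκ hγ hγ' Dm.isNewformOf D ϖ hϖ
    obtain ⟨hS, hspan, hReg, hcard⟩ := charIdeal_eq_span_of_iota_eq_C_mul_of_linearCoeff_rankOne hp2 hr1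
      hBcl hκ hγ hγ' D hXt hg hι h1 hv hfull
    exact ⟨hXt, hS, hReg, hcard, g, u, hspan, hι⟩
  obtain ⟨κ₀, γ₀, hκ₀, hγ₀, hγ₀', D₀, -, -⟩ := exists_cyclotomic_dualData_generator W p
  obtain ⟨-, hS, hReg, hcard, -⟩ := core κ₀ γ₀ hκ₀ hγ₀ hγ₀' D₀
  refine ⟨?_, hS, hReg, hcard⟩
  intro κ γ N _ f ε α B _ haddv _ hκ hγ hcv hf _ hα hB D
  obtain ⟨hXt, -, -, -, g₁, u, hspan, hι⟩ := core κ γ hκ hγ hcv D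
  exact ⟨hXt, exists_charIdeal_eq_span_and_iota_eq_of_generator hp2 V C hC haddv hV hf
    (exists_ratPlusSymbol_ne_zero_of_isNewformOf hf) Dm hϖ0 hspan hι hB0 hα hB⟩

/-! ### §3 X3♯(M) (`E[p]` reducible, `E♭` multiplicative at `p`), EVERY odd `p` -/

/-- **HEADLINE X3♯(M), RANK ONE: THE A′-INEQUALITY ALONE.** X3♯(M), `p` odd, `ord_{s=1} L(E,s) = 1`, a
(B)-datum `Dh` (`mainTheorem_potMult`), `v ≤ ord_p Reg_p(E,Dh)`; per pair ONLY `[T¹](ϖ·L^±) ≠ 0` and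
**`v_p([T¹](ϖ·L^±)) + 1 + 2·ord_p #tors ≤ v + ord_p ∏c_ℓ`**. Then **`TameBranchRatCharEqAt W p`**, Schneider,
**`ord_p Reg_p(E,Dh) = v`**, **`#Ш(E/ℚ)[p^∞] = 1`**. [cite: Wuthrich2014, Thm. 16 (p. 397)]
[cite: Delbourgo2002, Theorem (A), (B) (p. 40), p. 39] [cite: MazurTateTeitelbaum1986Invent, §I.10, §I.13–I.14] -/
theorem ClassX3M.tameBranchRatCharEqAt_of_wuthrichHalf_of_linearCoeff_rankOne
    (hWu : Wuthrich2014.thm16_halfEigenCharIdeal_dvd_cyclotomicPrime)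
    (hmodD : nonempty_modularParametrizationData)
    (hGZK : rank_eq_analyticRank_of_analyticRank_le_one)
    (hX : ClassX3M W p) (hr : W.analyticRank = 1)
    {Dh : PAdicHeightData W p} (hBcl : LeadingTermClauses W p Dh)
    {v : ℤ} (hv : v ≤ (padicRegulator Dh).valuation)
    (hcert : ∀ (V : WeierstrassCurve ℚ) [V.IsElliptic] [V.IsGloballyMinimal] (C : VariableChange ℚ),
      Mult V p → C • V.quadraticTwist ((-1 : ℚ) ^ (p / 2) * p) = W →
      ∀ {N : ℕ} [NeZero N] (f : CuspForm (Gamma0 N) 2), IsNewformOf V f → ∀ (ap : ℤ), cuspCoeff f p = ap →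
      ∀ ϖ : ℚ, (if Even (p / 2) then (ϖ : ℝ) * V.realPeriodRat = plusPeriod f
          else (ϖ : ℝ) * V.imaginaryPeriodRat = minusPeriod f) →
        PowerSeries.coeff 1 (PowerSeries.C (ϖ : ℚ_[p]) *
            (if Even (p / 2) then padicLFunctionPlusBranchMult f ((ap : ℤ) : ℚ_[p]) (p / 2)
              else padicLFunctionMinusBranchMult f ((ap : ℤ) : ℚ_[p]) (p / 2))) ≠ 0 ∧
        (PowerSeries.coeff 1 (PowerSeries.C (ϖ : ℚ_[p]) *
            (if Even (p / 2) then padicLFunctionPlusBranchMult f ((ap : ℤ) : ℚ_[p]) (p / 2)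
              else padicLFunctionMinusBranchMult f ((ap : ℤ) : ℚ_[p]) (p / 2)))).valuation +
            1 + 2 * padicValNat p W.torsionOrder ≤ v + padicValNat p W.tamagawaProduct) :
    TameBranchRatCharEqAt W p ∧ SchneiderConjecture Dh ∧ (padicRegulator Dh).valuation = v ∧
      Nat.card (AddCommGroup.primaryComponent W.sha p) = 1 := by
  have hp2 : p ≠ 2 := hX.p_ne_two
  obtain ⟨hmw, -⟩ := hGZK W (by rw [hr])
  have hr1 : W.mordellWeilRank = 1 := by rw [hmw, hr]
  obtain ⟨V, iV, iVm, C, hV, hC⟩ := hX.exists_mult_pStar_twist_model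
  haveI : NeZero (V.conductorNorm ℤ) := ⟨(V.conductorNorm_pos_holds).ne'⟩
  obtain ⟨Dm⟩ := hmodD V
  obtain ⟨ϖ, hϖ⟩ := exists_periodRatio_parity (p := p) V Dm
  have hirrV : ¬ V.HasIrreducibleModPGaloisRep p := fun hVirr ↦
    hX.classX3.1 ((irr_iff_of_model_twist (W := V) (p := p) (pStar_ne_zero p) ⟨C, hC⟩).mpr hVirr)
  have hsign : ∃ ap : ℤ, cuspCoeff Dm.f p = ap ∧
      ∀ (κ : ZpExtension ℚ p) (γ : Field.absoluteGaloisGroup ℚ), κ.IsCyclotomic → κ.IsTopGenerator γ →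
        IsCyclotomicVariable p γ → ∀ D : W.SelmerDualData κ γ,
        D.IsTorsion ∧ ∃ g ∈ D.charIdeal, ∃ u : ℤ_[p]ˣ,
          iwasawaToPowerSeries p g = PowerSeries.C (((u : ℤ_[p]) : ℚ_[p]) * (ϖ : ℚ_[p])) *
            (if Even (p / 2) then padicLFunctionPlusBranchMult Dm.f ((ap : ℤ) : ℚ_[p]) (p / 2)
              else padicLFunctionMinusBranchMult Dm.f ((ap : ℤ) : ℚ_[p]) (p / 2)) := by
    by_cases hs : V.HasSplitMultiplicativeReductionAtPrime p
    · refine ⟨1, (Dm.isNewformOf.cuspCoeff_eq_one_and_sq_of_split hs).1.trans (by norm_num),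
        fun κ γ hκ hγ hcv D ↦ ?_⟩
      simpa only [Int.cast_one] using isTorsion_and_exists_iota_eq_of_wuthrichHalf hWu hp2 V C hC hirrV hκ
        hγ hcv Dm.isNewformOf D _ (Or.inr (Or.inl ⟨hs, rfl⟩)) ϖ hϖ
    · refine ⟨-1, (Dm.isNewformOf.cuspCoeff_eq_neg_one_and_dvd_of_nonsplit hV hs).1.trans
        (by norm_num), fun κ γ hκ hγ hcv D ↦ ?_⟩
      simpa only [Int.cast_neg, Int.cast_one] using isTorsion_and_exists_iota_eq_of_wuthrichHalf hWu hp2 V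
        C hC hirrV hκ hγ hcv Dm.isNewformOf D _ (Or.inr (Or.inr ⟨hV, hs, rfl⟩)) ϖ hϖ
  obtain ⟨ap, hap, hbrick⟩ := hsign
  obtain ⟨h1, hfull⟩ := hcert V C hV hC Dm.f Dm.isNewformOf ap hap ϖ hϖ
  have hϖ0 : ϖ ≠ 0 := by
    rintro rfl; apply h1; rw [Rat.cast_zero, map_zero, zero_mul, map_zero]
  have hB0 : (if Even (p / 2) then padicLFunctionPlusBranchMult Dm.f ((ap : ℤ) : ℚ_[p]) (p / 2)
      else padicLFunctionMinusBranchMult Dm.f ((ap : ℤ) : ℚ_[p]) (p / 2)) ≠ 0 := by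
    intro e; apply h1; rw [e, mul_zero, map_zero]
  have core : ∀ (κ : ZpExtension ℚ p) (γ : Field.absoluteGaloisGroup ℚ), κ.IsCyclotomic →
      κ.IsTopGenerator γ → IsCyclotomicVariable p γ → ∀ D : W.SelmerDualData κ γ,
      D.IsTorsion ∧ SchneiderConjecture Dh ∧ (padicRegulator Dh).valuation = v ∧
        Nat.card (AddCommGroup.primaryComponent W.sha p) = 1 ∧ ∃ (g : IwasawaAlgebra p) (u : ℤ_[p]ˣ),
        D.charIdeal = Ideal.span {g} ∧ iwasawaToPowerSeries p g =
          PowerSeries.C (((u : ℤ_[p]) : ℚ_[p]) * (ϖ : ℚ_[p])) *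
            (if Even (p / 2) then padicLFunctionPlusBranchMult Dm.f ((ap : ℤ) : ℚ_[p]) (p / 2)
              else padicLFunctionMinusBranchMult Dm.f ((ap : ℤ) : ℚ_[p]) (p / 2)) := by
    intro κ γ hκ hγ hγ' D
    haveI : Module.Finite (IwasawaAlgebra p) D.X :=
      SelmerDualData.module_finite_of_isCyclotomic (W := W) (κ := κ) hκ D hγ
    obtain ⟨hXt, g, hg, u, hι⟩ := hbrick κ γ hκ hγ hγ' D
    obtain ⟨hS, hspan, hReg, hcard⟩ := charIdeal_eq_span_of_iota_eq_C_mul_of_linearCoeff_rankOne hp2 hr1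
      hBcl hκ hγ hγ' D hXt hg hι h1 hv hfull
    exact ⟨hXt, hS, hReg, hcard, g, u, hspan, hι⟩
  obtain ⟨κ₀, γ₀, hκ₀, hγ₀, hγ₀', D₀, -, -⟩ := exists_cyclotomic_dualData_generator W p
  obtain ⟨-, hS, hReg, hcard, -⟩ := core κ₀ γ₀ hκ₀ hγ₀ hγ₀' D₀
  refine ⟨?_, hS, hReg, hcard⟩
  intro κ γ N _ f ε α B _ haddv _ hκ hγ hcv hf _ hα hB D
  obtain ⟨hXt, -, -, -, g₁, u, hspan, hι⟩ := core κ γ hκ hγ hcv D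
  exact ⟨hXt, exists_charIdeal_eq_span_and_iota_eq_of_generator_mult hp2 V C hC haddv hV hf
    (exists_ratPlusSymbol_ne_zero_of_isNewformOf hf) Dm hap hϖ0 hspan hι hB0 hα hB⟩

end Twins

end Summit.BirchSwinnertonDyer.Rank1Residual.Additive

end
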